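import Literature.Analysis.FluidPDE.GaussianVortexSchauderExistence
import Literature.Analysis.FluidPDE.IsometryInvariance
import HarnessLib

/-!
# Gallay–Maekawa 2016, Theorem 4.1: existence of asymmetric Burgers vortices (discharge)

Analysis/FluidPDE file (all results proved; no definitions, no named facts) discharging the named
fact `GallayMaekawa2016_thm41`
(`Literature/Analysis/FluidPDE/GaussianVortexPlanar.lean`): for every asymmetry `λ ∈ [0,1)` and
every circulation `α ∈ ℝ` the weak asymmetric Burgers problem (4.2) has a solution
`ω ∈ L¹ ∩ L²(∞;λ)` with `∫ ω = α`.

* `α ≥ 0`: `GaussianVortexSchauderExistence.exists_weakSolution_nonneg` gives `U = (u, G)` in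
  the weighted form domain `H¹(μ_λ)` with `u ≥ 0`, `∫ u dμ_λ = α`, a bounded velocity
  `v = K_{2D} ∗ (ρ_λ u)` and `⟪G, G_Φ⟫ = ∫ u ⟪v, G_Φ⟫ dμ_λ` on `H¹(μ_λ)`; with `ω = ρ_λ u` and
  the test pair `Φ = (φ, ∇φ)`, the weighted Green identity
  `⟪u, Δφ − b_λ·∇φ⟫_{μ_λ} = −⟪G, ∇φ⟫_{μ_λ}` (`inner_fst_gaussLamAdjointLp_eq`) turns this into the
  flat weak formulation (4.2) (`exists_weakBurgersData_nonneg`, `isWeakAsymBurgersVortex_of_data`).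
* `α < 0`: the reflection `S(x₁, x₂) = (x₁, −x₂)` (`exists_reflectX2`, from
  `BiotSavart2DSymmetry.exists_planarReflection`) commutes with `L_λ`, and `ω' = −ω ∘ S` has
  velocity `S ∘ v ∘ S` (`K_{2D}(Sz) = −S K_{2D}(z)`, `biotSavart2D_neg_comp_reflX2`), so `ω'` solves
  (4.2) with circulation `−α` (`weakBurgersData_reflect`).
* `GallayMaekawa2016_thm41_holds` assembles the two cases.

## References

* Th. Gallay, Y. Maekawa, *Existence and stability of viscous vortices*, arXiv:1610.08384, §4.1,
  Thm. 4.1 (M2 = Y. Maekawa, M3AS 19 (2009)). [GallayMaekawa2016]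
* D. Gilbarg, N. S. Trudinger, *Elliptic Partial Differential Equations of Second Order*,
  Springer (2001), Cor. 11.2. [GilbargTrudinger2001]
-/

open MeasureTheory Filter Set WithLp Metric
open scoped Real RealInnerProductSpace Topology InnerProductSpace ContDiff Laplacian

noncomputable section

namespace Literature.Analysis.FluidPDE

open Literature.Analysis.UnboundedOperators

variable {lam : ℝ}

/-! ### The data of a weak solution with bounded velocity -/

/-- Integrability from a bound by an integrable function. [folklore] -/
private theorem integrable_of_norm_le_const_mul_th41 {X F G' : Type*} [MeasurableSpace X] {μ : Measure X}
    [NormedAddCommGroup F] [NormedAddCommGroup G'] {f : X → F} {g : X → G'} (hg : Integrable g μ)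
    (hf : AEStronglyMeasurable f μ) (C : ℝ) (h : ∀ x, ‖f x‖ ≤ C * ‖g x‖) : Integrable f μ :=
  (hg.norm.const_mul C).mono' hf (Eventually.of_forall h)

/-- Data with bounded velocity give a weak asymmetric Burgers vortex in `L²(∞;λ)`
(`ω v ∈ L¹ ⊆ L¹_loc` since `v` is bounded and measurable). [folklore] -/
theorem isWeakAsymBurgersVortex_of_data {α V : ℝ} {w : EuclideanSpace ℝ (Fin 2) → ℝ}
    (h : Measurable w ∧ Integrable w ∧ ∫ x, w x = α ∧ (∀ x, ‖biotSavart2D w x‖ ≤ V) ∧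
      (∀ φ : EuclideanSpace ℝ (Fin 2) → ℝ, ContDiff ℝ ∞ φ → HasCompactSupport φ →
        ∫ x, w x * (Δ φ x - ((1 + lam) / 2 * x 0 * fderiv ℝ φ x (EuclideanSpace.single 0 1) +
            (1 - lam) / 2 * x 1 * fderiv ℝ φ x (EuclideanSpace.single 1 1)) +
          ⟪biotSavart2D w x, gradient φ x⟫) = 0) ∧
      MemL2InftyLam lam w) :
    IsWeakAsymBurgersVortex lam α w ∧ MemL2InftyLam lam w := by
  obtain ⟨hwm, hwi, hmass, hv, hweak, hmem⟩ := h
  refine ⟨⟨hwi, hmass, ?_, hweak⟩, hmem⟩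
  refine Integrable.locallyIntegrable ?_
  refine integrable_of_norm_le_const_mul_th41 hwi
    (hwi.aestronglyMeasurable.smul (stronglyMeasurable_biotSavart2D hwm).aestronglyMeasurable) V fun x => ?_
  rw [norm_smul, mul_comm V]
  exact mul_le_mul_of_nonneg_left (hv x) (norm_nonneg _)

/-! ### `α ≥ 0`: unpacking the weighted weak solution -/

section Nonneg

variable (hlam : lam ∈ Set.Ico (0 : ℝ) 1)
include hlam

/-- **Weak asymmetric Burgers vortices of circulation `α ≥ 0`**: the weighted weak solution of
`exists_weakSolution_nonneg`, `ω = ρ_λ u`, is a weak solution of (4.2) with bounded velocity and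
`ω ∈ L²(∞;λ)`. [cite: GallayMaekawa2016, Thm. 4.1] -/
theorem exists_weakBurgersData_nonneg {α : ℝ} (hα : 0 ≤ α) :
    ∃ (V : ℝ) (w : EuclideanSpace ℝ (Fin 2) → ℝ), Measurable w ∧ Integrable w ∧ ∫ x, w x = α ∧ (∀ x, ‖biotSavart2D w x‖ ≤ V) ∧
      (∀ φ : EuclideanSpace ℝ (Fin 2) → ℝ, ContDiff ℝ ∞ φ → HasCompactSupport φ →
        ∫ x, w x * (Δ φ x - ((1 + lam) / 2 * x 0 * fderiv ℝ φ x (EuclideanSpace.single 0 1) +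
            (1 - lam) / 2 * x 1 * fderiv ℝ φ x (EuclideanSpace.single 1 1)) +
          ⟪biotSavart2D w x, gradient φ x⟫) = 0) ∧
      MemL2InftyLam lam w := by
  have hq : 0 < 1 - lam := by linarith [hlam.2]
  haveI := isFiniteMeasure_gaussLamMeasure hlam
  obtain ⟨U, hU, -, hmass, hv, hweak⟩ := exists_weakSolution_nonneg hlam hα
  set ut : EuclideanSpace ℝ (Fin 2) → ℝ := (U.fst : EuclideanSpace ℝ (Fin 2) → ℝ) with hut
  set ρ : EuclideanSpace ℝ (Fin 2) → ℝ := fun x =>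
    Real.exp (-((1 + lam) / 4 * x 0 ^ 2 + (1 - lam) / 4 * x 1 ^ 2)) with hρ_def
  have hρpos : ∀ x, 0 < ρ x := fun x => Real.exp_pos _
  set w : EuclideanSpace ℝ (Fin 2) → ℝ := fun x => ρ x * ut x with hw_def
  have hwm : Measurable w := measurable_weight_mul_Lp U.fst
  obtain ⟨hwi, -⟩ := integrable_weight_mul_Lp hlam U.fst
  have hwi' : Integrable w := hwi
  set v := biotSavart2D w with hv_def
  have hvm : StronglyMeasurable v := stronglyMeasurable_biotSavart2D hwm
  have hvb : ∀ x, ‖v x‖ ≤ schauderV0 hlam α := hv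
  set M : ℝ := schauderV0 hlam α with hM
  have hM0 : 0 ≤ M := (norm_nonneg _).trans (hvb 0)
  have huti : Integrable ut (gaussLamMeasure lam) := (Lp.memLp U.fst).integrable one_le_two
  refine ⟨M, w, hwm, hwi', ?_, hvb, ?_, ?_⟩
  · -- `∫ w = α`
    have h1 : ∫ x, w x = ∫ x, ut x ∂gaussLamMeasure lam := by
      rw [integral_gaussLamMeasure]
      exact integral_congr_ae (Eventually.of_forall fun x => mul_comm _ _)
    rw [h1, ← inner_gaussLamOne_left hlam, hmass]
  · -- the weak equation
    intro φ hφ hφc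
    set ψ : planarTestFunctions := ⟨φ, hφ, hφc⟩ with hψ_def
    have hφψ : (ψ : EuclideanSpace ℝ (Fin 2) → ℝ) = φ := rfl
    obtain ⟨C₁, hC₁⟩ := planarTestFunctions.exists_bound_fderiv ψ
    rw [hφψ] at hC₁
    have hgradφ : ∀ x, ‖gradient φ x‖ ≤ C₁ := fun x => by
      rw [gradient, LinearIsometryEquiv.norm_map]; exact hC₁ x
    have hgradc : Continuous (gradient φ) := planarTestFunctions.continuous_gradient ψ
    -- the adjoint `Aφ = Δφ − b·∇φ` is bounded
    set Aφ : EuclideanSpace ℝ (Fin 2) → ℝ := fun x => Δ φ x -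
      ((1 + lam) / 2 * x 0 * fderiv ℝ φ x (EuclideanSpace.single 0 1) +
        (1 - lam) / 2 * x 1 * fderiv ℝ φ x (EuclideanSpace.single 1 1)) with hAφ
    have hAc : Continuous Aφ := (continuous_laplacian_fin_two hφ).sub (continuous_adjointDrift hφ lam)
    have hAs : HasCompactSupport Aφ :=
      (hasCompactSupport_laplacian_fin_two hφ hφc).sub (hasCompactSupport_adjointDrift hφc lam)
    obtain ⟨CA, hCA⟩ := hAc.bounded_above_of_compact_support hAs
    -- `∫ w Aφ = ⟪u, Aφ⟫_μ = −⟪G, ∇φ⟫_μ = −∫ u ⟪v, ∇φ⟫ dμ = −∫ w ⟪v, ∇φ⟫`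
    have hI1 : ∫ x, w x * Aφ x = -∫ x, ut x * ⟪v x, gradient φ x⟫ ∂gaussLamMeasure lam := by
      have h1 : ∫ x, w x * Aφ x = ⟪U.fst, gaussLamAdjointLp lam ψ⟫ := by
        rw [inner_gaussLamAdjointLp]
        refine integral_congr_ae (Eventually.of_forall fun x => ?_)
        show ρ x * ut x * Aφ x = ut x * Aφ x * ρ x
        ring
      have h2 : ⟪U.snd, (gaussLamGraph lam ψ).snd⟫ = ∫ x, ut x * ⟪v x, gradient φ x⟫ ∂gaussLamMeasure lam := by
        rw [hweak _ (gaussLamGraph_mem lam ψ)]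
        refine integral_congr_ae ?_
        filter_upwards [MemLp.coeFn_toLp (memLp_gradient_planarTestFunction lam ψ)] with x hx
        rw [gaussLamGraph_snd, hx]
      rw [h1, inner_fst_gaussLamAdjointLp_eq hlam hU, h2]
    have hI2 : ∫ x, w x * ⟪v x, gradient φ x⟫ = ∫ x, ut x * ⟪v x, gradient φ x⟫ ∂gaussLamMeasure lam := by
      rw [integral_gaussLamMeasure]
      refine integral_congr_ae (Eventually.of_forall fun x => ?_)
      show ρ x * ut x * ⟪v x, gradient φ x⟫ = ut x * ⟪v x, gradient φ x⟫ * ρ x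
      ring
    have hwA : Integrable fun x => w x * Aφ x := by
      refine integrable_of_norm_le_const_mul_th41 hwi' (hwi'.aestronglyMeasurable.mul hAc.aestronglyMeasurable) CA
        fun x => ?_
      rw [norm_mul, mul_comm CA]
      exact mul_le_mul_of_nonneg_left (hCA x) (norm_nonneg _)
    have hwv : Integrable fun x => w x * ⟪v x, gradient φ x⟫ := by
      refine integrable_of_norm_le_const_mul_th41 hwi'
        (hwi'.aestronglyMeasurable.mul (hvm.aestronglyMeasurable.inner hgradc.aestronglyMeasurable)) (M * C₁)
        fun x => ?_
      rw [norm_mul, mul_comm (M * C₁)]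
      refine mul_le_mul_of_nonneg_left ?_ (norm_nonneg _)
      rw [Real.norm_eq_abs]
      exact (abs_real_inner_le_norm _ _).trans (mul_le_mul (hvb x) (hgradφ x) (norm_nonneg _) hM0)
    have hsplit : ∫ x, w x * (Aφ x + ⟪biotSavart2D w x, gradient φ x⟫) =
        (∫ x, w x * Aφ x) + ∫ x, w x * ⟪v x, gradient φ x⟫ := by
      rw [← integral_add hwA hwv]
      refine integral_congr_ae (Eventually.of_forall fun x => ?_)
      show w x * (Aφ x + ⟪biotSavart2D w x, gradient φ x⟫) = w x * Aφ x + w x * ⟪v x, gradient φ x⟫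
      rw [mul_add]
    have hgoal : ∫ x, w x * (Aφ x + ⟪biotSavart2D w x, gradient φ x⟫) = 0 := by
      rw [hsplit, hI1, hI2]
      ring
    simpa only [hAφ] using hgoal
  · -- `w ∈ L²(∞, λ)`
    refine memL2InftyLam_of_integrable_sq_div_expNegQuadLam hlam hwi'.aestronglyMeasurable ?_
    have h2 : Integrable (fun x => ut x ^ 2) (gaussLamMeasure lam) :=
      (memLp_two_iff_integrable_sq (Lp.aestronglyMeasurable U.fst)).1 (Lp.memLp U.fst)
    rw [integrable_gaussLamMeasure_iff] at h2
    refine h2.congr (Eventually.of_forall fun x => ?_)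
    show ut x ^ 2 * ρ x = (ρ x * ut x) ^ 2 / ρ x
    field_simp [(hρpos x).ne']

end Nonneg

/-! ### The reflection `S(x₁, x₂) = (x₁, −x₂)` and `α < 0` -/

section Reflect

/-- **The reflection `S(x₁, x₂) = (x₁, −x₂)`** exists as a linear isometry equivalence of `ℝ²`
(the reflection across the `x₁`-axis of `BiotSavart2DSymmetry.exists_planarReflection`). [folklore] -/
theorem exists_reflectX2 : ∃ S : EuclideanSpace ℝ (Fin 2) ≃ₗᵢ[ℝ] EuclideanSpace ℝ (Fin 2),
    (∀ z : EuclideanSpace ℝ (Fin 2), S z 0 = z 0) ∧ ∀ z : EuclideanSpace ℝ (Fin 2), S z 1 = -z 1 := by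
  set e0 : EuclideanSpace ℝ (Fin 2) := EuclideanSpace.single 0 1 with he0
  set e1 : EuclideanSpace ℝ (Fin 2) := EuclideanSpace.single 1 1 with he1
  have he0ne : e0 ≠ 0 := fun h => by
    have := congrArg (fun z : EuclideanSpace ℝ (Fin 2) => z 0) h
    simp [he0] at this
  obtain ⟨S, hSe0, hSperp⟩ := exists_planarReflection he0ne
  have hpe : perp e0 = e1 := by
    ext i; fin_cases i <;> simp [he0, he1, perp_apply_zero, perp_apply_one]
  have hSe1 : S e1 = -e1 := by
    have h := hSperp e0
    rw [hSe0, hpe] at h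
    rw [← neg_neg (S e1), ← h]
  have hz : ∀ z : EuclideanSpace ℝ (Fin 2), z = z 0 • e0 + z 1 • e1 := fun z => by
    ext i; fin_cases i <;> simp [he0, he1]
  refine ⟨S, fun z => ?_, fun z => ?_⟩
  · conv_lhs => rw [hz z]
    rw [map_add, map_smul, map_smul, hSe0, hSe1]
    simp [he0, he1]
  · conv_lhs => rw [hz z]
    rw [map_add, map_smul, map_smul, hSe0, hSe1]
    simp [he0, he1]

variable (S : EuclideanSpace ℝ (Fin 2) ≃ₗᵢ[ℝ] EuclideanSpace ℝ (Fin 2))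
  (hS0 : ∀ z : EuclideanSpace ℝ (Fin 2), S z 0 = z 0) (hS1 : ∀ z : EuclideanSpace ℝ (Fin 2), S z 1 = -z 1)
include hS0 hS1

/-- `S` is an involution. [folklore] -/
theorem reflX2_reflX2 (x : EuclideanSpace ℝ (Fin 2)) : S (S x) = x := by
  ext i; fin_cases i <;> simp [hS0, hS1]

/-- `S⁻¹ = S`. [folklore] -/
theorem reflX2_symm_apply (x : EuclideanSpace ℝ (Fin 2)) : S.symm x = S x := by
  calc S.symm x = S.symm (S (S x)) := by rw [reflX2_reflX2 S hS0 hS1]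
    _ = S x := S.symm_apply_apply _

/-- `S` anticommutes with `⊥`: `(Sz)^⊥ = −S(z^⊥)`. [folklore] -/
theorem perp_reflX2 (z : EuclideanSpace ℝ (Fin 2)) : perp (S z) = (-1 : ℝ) • S (perp z) := by
  ext i; fin_cases i <;> simp [perp_apply_zero, perp_apply_one, hS0, hS1]

/-- `S e₁ = e₁`. [folklore] -/
theorem reflX2_single_zero : S (EuclideanSpace.single 0 1) = EuclideanSpace.single 0 1 := by
  ext i; fin_cases i <;> simp [hS0, hS1]

/-- `S e₂ = −e₂`. [folklore] -/
theorem reflX2_single_one : S (EuclideanSpace.single 1 1) = -EuclideanSpace.single 1 1 := by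
  ext i; fin_cases i <;> simp [hS0, hS1]

omit hS0 hS1 in
/-- The anisotropic Gaussian weight `G_λ` is `S`-invariant. [folklore] -/
theorem gaussWeightLam_reflX2 (lam : ℝ) (x : EuclideanSpace ℝ (Fin 2)) :
    gaussWeightLam lam (S x) = gaussWeightLam lam x := by
  rw [gaussWeightLam, gaussWeightLam, LinearIsometryEquiv.norm_map]

/-- **The velocity of the reflected vortex**: for `ω' = −ω ∘ S`,
`K_{2D} ∗ ω' = S ∘ (K_{2D} ∗ ω) ∘ S` (change of variables, `K_{2D}(Sz) = −S K_{2D}(z)`). [folklore] -/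
theorem biotSavart2D_neg_comp_reflX2 (w : EuclideanSpace ℝ (Fin 2) → ℝ) (x : EuclideanSpace ℝ (Fin 2)) :
    biotSavart2D (fun y => -w (S y)) x = S (biotSavart2D w (S x)) := by
  unfold biotSavart2D
  have h1 : ∫ y, (-w (S (S y))) • biotSavartKernel2D (x - S y) =
      ∫ y, (-w (S y)) • biotSavartKernel2D (x - y) :=
    S.measurePreserving.integral_comp S.toHomeomorph.measurableEmbedding
      (fun y => (-w (S y)) • biotSavartKernel2D (x - y))
  rw [← h1]
  have h2 : ∀ y, biotSavartKernel2D (x - S y) = -S (biotSavartKernel2D (S x - y)) := fun y => by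
    conv_lhs => rw [← reflX2_reflX2 S hS0 hS1 x]
    rw [← map_sub, biotSavartKernel2D_linearIsometryEquiv S (perp_reflX2 S hS0 hS1), neg_one_smul]
  simp only [reflX2_reflX2 S hS0 hS1, h2, smul_neg, neg_smul, neg_neg]
  simp_rw [← LinearIsometryEquiv.map_smul]
  rw [← LinearIsometryEquiv.coe_toContinuousLinearEquiv, ContinuousLinearEquiv.integral_comp_comm]

/-- **Reflection of weak solutions**: if `ω` is a weak asymmetric Burgers vortex with data
`(α, V)`, then `ω' = −ω ∘ S` is one with data `(−α, V)` — `S` commutes with `L_λ`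
(`Δ`, and the drift `b_λ = (½(1+λ)x₁, ½(1−λ)x₂)` is `S`-equivariant), and the nonlinearity is
odd under `ω ↦ −ω ∘ S` since the velocity becomes `S ∘ v ∘ S`. [folklore] -/
theorem weakBurgersData_reflect {α V : ℝ} {w : EuclideanSpace ℝ (Fin 2) → ℝ}
    (h : Measurable w ∧ Integrable w ∧ ∫ x, w x = α ∧ (∀ x, ‖biotSavart2D w x‖ ≤ V) ∧
      (∀ φ : EuclideanSpace ℝ (Fin 2) → ℝ, ContDiff ℝ ∞ φ → HasCompactSupport φ →
        ∫ x, w x * (Δ φ x - ((1 + lam) / 2 * x 0 * fderiv ℝ φ x (EuclideanSpace.single 0 1) +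
            (1 - lam) / 2 * x 1 * fderiv ℝ φ x (EuclideanSpace.single 1 1)) +
          ⟪biotSavart2D w x, gradient φ x⟫) = 0) ∧
      MemL2InftyLam lam w) :
    Measurable (fun x => -w (S x)) ∧ Integrable (fun x => -w (S x)) ∧ ∫ x, -w (S x) = -α ∧ (∀ x, ‖biotSavart2D (fun x => -w (S x)) x‖ ≤ V) ∧
      (∀ φ : EuclideanSpace ℝ (Fin 2) → ℝ, ContDiff ℝ ∞ φ → HasCompactSupport φ →
        ∫ x, -w (S x) * (Δ φ x - ((1 + lam) / 2 * x 0 * fderiv ℝ φ x (EuclideanSpace.single 0 1) +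
            (1 - lam) / 2 * x 1 * fderiv ℝ φ x (EuclideanSpace.single 1 1)) +
          ⟪biotSavart2D (fun x => -w (S x)) x, gradient φ x⟫) = 0) ∧
      MemL2InftyLam lam fun x => -w (S x) := by
  obtain ⟨hwm, hwi, hmass, hv, hweak, hmem⟩ := h
  have hmp : MeasurePreserving S (volume : Measure (EuclideanSpace ℝ (Fin 2))) volume :=
    S.measurePreserving
  have hemb : MeasurableEmbedding S := S.toHomeomorph.measurableEmbedding
  have hwSi : Integrable (fun x => w (S x)) := (hmp.integrable_comp_emb hemb).2 hwi
  refine ⟨(hwm.comp S.continuous.measurable).neg, hwSi.neg, ?_, ?_, ?_, ?_⟩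
  · -- mass
    rw [integral_neg, hmp.integral_comp hemb, hmass]
  · -- velocity bound
    intro x
    rw [biotSavart2D_neg_comp_reflX2 S hS0 hS1, LinearIsometryEquiv.norm_map]
    exact hv _
  · -- the weak equation
    intro φ hφ hφc
    set φ' : EuclideanSpace ℝ (Fin 2) → ℝ := fun y => φ (S y) with hφ'
    have hφ'd : ContDiff ℝ ∞ φ' := hφ.comp S.toContinuousLinearEquiv.contDiff
    have hφ'c : HasCompactSupport φ' := hφc.comp_homeomorph S.toHomeomorph
    have key := hweak φ' hφ'd hφ'c
    have hfun : (fun y => φ (S.symm y)) = φ' := by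
      funext y; rw [reflX2_symm_apply S hS0 hS1]
    -- pointwise transformation of the integrand
    have hΔ : ∀ y, Δ φ' y = Δ φ (S y) := fun y => by
      have := laplacian_comp_linearIsometryEquiv_symm S φ y
      rwa [hfun, reflX2_symm_apply S hS0 hS1] at this
    have hfd : ∀ y, fderiv ℝ φ' y = (fderiv ℝ φ (S y)).comp
        (S.toContinuousLinearEquiv : EuclideanSpace ℝ (Fin 2) →L[ℝ] EuclideanSpace ℝ (Fin 2)) := fun y =>
      S.toContinuousLinearEquiv.comp_right_fderiv
    have hfd0 : ∀ y, fderiv ℝ φ' y (EuclideanSpace.single 0 1) = fderiv ℝ φ (S y) (EuclideanSpace.single 0 1) :=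
      fun y => by
      rw [hfd, ContinuousLinearMap.comp_apply]
      show fderiv ℝ φ (S y) (S (EuclideanSpace.single 0 1)) = _
      rw [reflX2_single_zero S hS0 hS1]
    have hfd1 : ∀ y, fderiv ℝ φ' y (EuclideanSpace.single 1 1) = -fderiv ℝ φ (S y) (EuclideanSpace.single 1 1) :=
      fun y => by
      rw [hfd, ContinuousLinearMap.comp_apply]
      show fderiv ℝ φ (S y) (S (EuclideanSpace.single 1 1)) = _
      rw [reflX2_single_one S hS0 hS1, map_neg]
    have hgrad : ∀ y, gradient φ' y = S (gradient φ (S y)) := fun y => by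
      have := gradient_comp_linearIsometryEquiv_symm S φ y
      rwa [hfun, reflX2_symm_apply S hS0 hS1] at this
    have hinner : ∀ (a g : EuclideanSpace ℝ (Fin 2)), ⟪a, S g⟫ = ⟪S a, g⟫ := fun a g => by
      rw [← S.inner_map_map a (S g), reflX2_reflX2 S hS0 hS1]
    have hvel : ∀ x, biotSavart2D (fun y => -w (S y)) x = S (biotSavart2D w (S x)) :=
      biotSavart2D_neg_comp_reflX2 S hS0 hS1 w
    have hpt : ∀ y, Δ φ' y - ((1 + lam) / 2 * y 0 * fderiv ℝ φ' y (EuclideanSpace.single 0 1) +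
        (1 - lam) / 2 * y 1 * fderiv ℝ φ' y (EuclideanSpace.single 1 1)) +
        ⟪biotSavart2D w y, gradient φ' y⟫ =
        Δ φ (S y) - ((1 + lam) / 2 * (S y) 0 * fderiv ℝ φ (S y) (EuclideanSpace.single 0 1) +
          (1 - lam) / 2 * (S y) 1 * fderiv ℝ φ (S y) (EuclideanSpace.single 1 1)) +
        ⟪S (biotSavart2D w y), gradient φ (S y)⟫ := fun y => by
      rw [hΔ, hfd0, hfd1, hgrad, hinner, hS0, hS1]
      ring
    have hg : ∀ x, -w (S x) * (Δ φ x - ((1 + lam) / 2 * x 0 * fderiv ℝ φ x (EuclideanSpace.single 0 1) +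
          (1 - lam) / 2 * x 1 * fderiv ℝ φ x (EuclideanSpace.single 1 1)) +
        ⟪biotSavart2D (fun y => -w (S y)) x, gradient φ x⟫) =
        -(w (S x) * (Δ φ' (S x) - ((1 + lam) / 2 * (S x) 0 * fderiv ℝ φ' (S x) (EuclideanSpace.single 0 1) +
          (1 - lam) / 2 * (S x) 1 * fderiv ℝ φ' (S x) (EuclideanSpace.single 1 1)) +
          ⟪biotSavart2D w (S x), gradient φ' (S x)⟫)) := fun x => by
      rw [hpt (S x), hvel x, reflX2_reflX2 S hS0 hS1]
      ring
    have hcomp : ∫ x, w (S x) * (Δ φ' (S x) - ((1 + lam) / 2 * (S x) 0 * fderiv ℝ φ' (S x) (EuclideanSpace.single 0 1) +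
          (1 - lam) / 2 * (S x) 1 * fderiv ℝ φ' (S x) (EuclideanSpace.single 1 1)) +
          ⟪biotSavart2D w (S x), gradient φ' (S x)⟫) =
        ∫ y, w y * (Δ φ' y - ((1 + lam) / 2 * y 0 * fderiv ℝ φ' y (EuclideanSpace.single 0 1) +
          (1 - lam) / 2 * y 1 * fderiv ℝ φ' y (EuclideanSpace.single 1 1)) +
          ⟪biotSavart2D w y, gradient φ' y⟫) :=
      hmp.integral_comp hemb (fun y => w y * (Δ φ' y - ((1 + lam) / 2 * y 0 * fderiv ℝ φ' y (EuclideanSpace.single 0 1) +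
          (1 - lam) / 2 * y 1 * fderiv ℝ φ' y (EuclideanSpace.single 1 1)) +
          ⟪biotSavart2D w y, gradient φ' y⟫))
    have hI : ∫ x, -w (S x) * (Δ φ x - ((1 + lam) / 2 * x 0 * fderiv ℝ φ x (EuclideanSpace.single 0 1) +
          (1 - lam) / 2 * x 1 * fderiv ℝ φ x (EuclideanSpace.single 1 1)) +
        ⟪biotSavart2D (fun y => -w (S y)) x, gradient φ x⟫) =
        -∫ x, w (S x) * (Δ φ' (S x) - ((1 + lam) / 2 * (S x) 0 * fderiv ℝ φ' (S x) (EuclideanSpace.single 0 1) +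
          (1 - lam) / 2 * (S x) 1 * fderiv ℝ φ' (S x) (EuclideanSpace.single 1 1)) +
          ⟪biotSavart2D w (S x), gradient φ' (S x)⟫) := by
      rw [← integral_neg]
      exact integral_congr_ae (Eventually.of_forall hg)
    show ∫ x, -w (S x) * (Δ φ x - ((1 + lam) / 2 * x 0 * fderiv ℝ φ x (EuclideanSpace.single 0 1) +
          (1 - lam) / 2 * x 1 * fderiv ℝ φ x (EuclideanSpace.single 1 1)) +
        ⟪biotSavart2D (fun y => -w (S y)) x, gradient φ x⟫) = 0
    rw [hI, hcomp, key, neg_zero]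
  · -- `L²(∞;λ)`
    refine ⟨(hwm.comp S.continuous.measurable).neg.aestronglyMeasurable, ?_⟩
    have h2 := (hmp.integrable_comp_emb hemb (g := fun x => w x ^ 2 / gaussWeightLam lam x)).2 hmem.2
    refine h2.congr (Eventually.of_forall fun x => ?_)
    show w (S x) ^ 2 / gaussWeightLam lam (S x) = (-w (S x)) ^ 2 / gaussWeightLam lam x
    rw [neg_sq, gaussWeightLam_reflX2 S]

end Reflect

/-! ### The theorem -/

/-- **Gallay–Maekawa 2016, Theorem 4.1 (existence of asymmetric Burgers vortices), discharged**:
for every `λ ∈ [0,1)` and every circulation `α ∈ ℝ` the weak problem (4.2) has a solution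
`ω ∈ L¹(ℝ²) ∩ L²(∞;λ)` with `∫ ω = α`. For `α ≥ 0` this is the Schauder fixed point of
`GaussianVortexSchauderExistence` in the ground-state variables; for `α < 0` one reflects across
the `x₁`-axis. [cite: GallayMaekawa2016, Thm. 4.1] -/
theorem GallayMaekawa2016_thm41_holds : GallayMaekawa2016_thm41 := by
  intro lam hlam α
  rcases le_or_gt 0 α with hα | hα
  · obtain ⟨V, w, hw⟩ := exists_weakBurgersData_nonneg hlam hα
    exact ⟨w, isWeakAsymBurgersVortex_of_data hw⟩
  · obtain ⟨V, w, hw⟩ := exists_weakBurgersData_nonneg hlam (α := -α) (by linarith)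
    obtain ⟨S, hS0, hS1⟩ := exists_reflectX2
    have h := weakBurgersData_reflect S hS0 hS1 hw
    rw [neg_neg] at h
    exact ⟨_, isWeakAsymBurgersVortex_of_data h⟩

end Literature.Analysis.FluidPDE
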